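import Literature.Probability.Process.ItoIntegralConstruction
import HarnessLib

/-!
# Route `ColdStartUniversality`, support item S (stmt-QuantumFields-24811), line `piwiener`:
# stub B1 — the pathwise (Riemann-sum) error term

Helper file (lead `ym-line-csu-p1`) for stub B1 `stub_tangentSumSq`.  Deterministic real analysis: for
continuous `y_k, b_k, σ_{k n'} : ℝ≥0 → ℝ` satisfying the tangency identity
`T1 : 2 Σ_k y_k b_k + Σ_{k,n'} σ_{k n'}² ≡ 0`, the level-`n` PATH term of the scaffold
`Σ_{j<N} Σ_k 2 y_k(g j) ∫_{g j}^{g(j+1)} b_k + Σ_{j<N} Σ_{k,n'} clamp n (σ_{k n'}(g j))² 2⁻ⁿ` (`g j = j/2ⁿ`,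
`N/2ⁿ = t`) equals `Σ_j ∫_{cell j} [Σ_k 2 (y_k(g j) − y_k(s)) b_k(s) + Σ (σ(g j)² − σ(s)²)] ds` once the clamp is
inactive, hence is bounded by `t (2|ι| B + |ι||κ|) η` with `B = sup_{[0,t]} |b|` and `η` the oscillation of
`y, σ²` at scale `2⁻ⁿ` (`abs_pathTerm_le`), and tends to `0` along any levels `n_l → ∞` with `N_l/2^{n_l} = t`
(`pathTerm_tendsto_zero`); likewise `Σ_{j<N} (∫_{cell j} b_k)² ≤ t B² 2⁻ⁿ → 0` (`quadSum_drift_tendsto_zero`).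

No definition, no sorry.  RECORD-rung plumbing; nothing here bears on the Yang–Mills mass gap. -/

set_option autoImplicit false

noncomputable section

namespace Summit.QuantumFields.YangMills.Theorems.ColdStartUniversality

open MeasureTheory Filter Topology Finset Literature
open scoped NNReal BigOperators
open Literature.Probability.Process

/-- Real coordinates of the dyadic grid: `((j/2ⁿ : ℝ≥0) : ℝ) = j/2ⁿ`. [folklore] -/
theorem coe_dyadicGrid (n j : ℕ) : ((((j : ℝ≥0) / 2 ^ n : ℝ≥0)) : ℝ) = (j : ℝ) / 2 ^ n := by
  push_cast; ring

/-- A point of the real cell `[j/2ⁿ, (j+1)/2ⁿ]` rounds (`toNNReal`) to a point of `[0, t]` within `2⁻ⁿ` of the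
left end point, when `(j+1)/2ⁿ ≤ t`. [folklore] -/
theorem toNNReal_mem_cell {n j : ℕ} {t : ℝ≥0} (hjt : (((j + 1 : ℕ) : ℝ≥0) / 2 ^ n) ≤ t) {s : ℝ}
    (hs : s ∈ Set.uIcc ((((j : ℝ≥0) / 2 ^ n : ℝ≥0)) : ℝ) ((((j + 1 : ℕ) : ℝ≥0) / 2 ^ n : ℝ≥0) : ℝ)) :
    s.toNNReal ≤ t ∧ ((j : ℝ≥0) / 2 ^ n) ≤ s.toNNReal ∧
      dist ((j : ℝ≥0) / 2 ^ n) s.toNNReal ≤ 1 / 2 ^ n := by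
  have h2 : (0 : ℝ) < 2 ^ n := pow_pos two_pos n
  have hle : ((((j : ℝ≥0) / 2 ^ n : ℝ≥0)) : ℝ) ≤ ((((j + 1 : ℕ) : ℝ≥0) / 2 ^ n : ℝ≥0) : ℝ) := by
    rw [coe_dyadicGrid, coe_dyadicGrid]
    exact div_le_div_of_nonneg_right (by exact_mod_cast Nat.le_succ j) h2.le
  rw [Set.uIcc_of_le hle, Set.mem_Icc] at hs
  have hs0 : 0 ≤ s := le_trans (by positivity) hs.1
  have hsnn : (s.toNNReal : ℝ) = s := Real.coe_toNNReal _ hs0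
  refine ⟨?_, ?_, ?_⟩
  · rw [← NNReal.coe_le_coe, hsnn]; exact hs.2.trans (by exact_mod_cast hjt)
  · rw [← NNReal.coe_le_coe, hsnn]; exact hs.1
  · rw [NNReal.dist_eq, hsnn, abs_sub_comm, abs_of_nonneg (by linarith [hs.1])]
    have := hs.2
    rw [coe_dyadicGrid] at this ⊢
    push_cast at this
    have : s - (j : ℝ) / 2 ^ n ≤ ((j : ℝ) + 1) / 2 ^ n - (j : ℝ) / 2 ^ n := by linarith
    refine this.trans_eq ?_
    field_simp
    ring

/-- **The PATH term at one level, clamp inactive.**  With `B` a bound for `|b_k|` on `[0, t]`, `η` a bound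
for the oscillations of `y_k` and `σ_{k n'}²` at scale `2⁻ⁿ` on `[0, t]`, `|σ| ≤ n` on `[0, t]` and all
`N` cells inside `[0, t]`:
`|Σ_{j<N} Σ_k 2 y_k(g j) ∫_{cell j} b_k + Σ_{j<N} Σ_{k,n'} clamp n (σ(g j))² 2⁻ⁿ| ≤ N 2⁻ⁿ (2|ι| B η + |ι||κ| η)`.
[folklore] -/
theorem abs_pathTerm_le {ι κ : Type*} [Fintype ι] [Fintype κ] (y b : ι → ℝ≥0 → ℝ) (σ : ι → κ → ℝ≥0 → ℝ)
    (hb : ∀ k, Continuous (b k))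
    (hT1 : ∀ s, 2 * ∑ k, y k s * b k s + ∑ k, ∑ n', σ k n' s ^ 2 = 0)
    {t : ℝ≥0} {n N : ℕ} (hNt : ((N : ℝ≥0) / 2 ^ n) ≤ t) {B η : ℝ} (hB : ∀ k, ∀ s ≤ t, |b k s| ≤ B)
    (hηy : ∀ k (s s' : ℝ≥0), s ≤ t → s' ≤ t → dist s s' ≤ 1 / 2 ^ n → |y k s - y k s'| ≤ η)
    (hησ : ∀ k n' (s s' : ℝ≥0), s ≤ t → s' ≤ t → dist s s' ≤ 1 / 2 ^ n →
      |σ k n' s ^ 2 - σ k n' s' ^ 2| ≤ η)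
    (hclamp : ∀ k n', ∀ s ≤ t, |σ k n' s| ≤ n) :
    |∑ j ∈ range N, ∑ k, 2 * y k ((j : ℝ≥0) / 2 ^ n) *
        (∫ s in ((((j : ℝ≥0) / 2 ^ n : ℝ≥0)) : ℝ)..((((j + 1 : ℕ) : ℝ≥0) / 2 ^ n : ℝ≥0) : ℝ), b k s.toNNReal) +
      ∑ j ∈ range N, ∑ k, ∑ n', clamp n (σ k n' ((j : ℝ≥0) / 2 ^ n)) ^ 2 * (1 / 2 ^ n)| ≤
      (N * (1 / 2 ^ n)) * (2 * Fintype.card ι * B * η + Fintype.card ι * Fintype.card κ * η) := by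
  have h2 : (0 : ℝ) < 2 ^ n := pow_pos two_pos n
  -- all cells lie inside `[0, t]`
  have hcell : ∀ j ∈ range N, (((j + 1 : ℕ) : ℝ≥0) / 2 ^ n) ≤ t := fun j hj =>
    (div_le_div_of_nonneg_right (by exact_mod_cast (mem_range.1 hj : j < N)) (pow_pos two_pos n).le).trans hNt
  have hstep : ∀ j : ℕ, ((((j + 1 : ℕ) : ℝ≥0) / 2 ^ n : ℝ≥0) : ℝ) - ((((j : ℝ≥0) / 2 ^ n : ℝ≥0)) : ℝ) =
      1 / 2 ^ n := fun j => by
    rw [coe_dyadicGrid, coe_dyadicGrid]; push_cast; field_simp; ring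
  -- the constant `Cst` bounding the cell integrands
  set Cst : ℝ := 2 * Fintype.card ι * B * η + Fintype.card ι * Fintype.card κ * η with hCst
  rw [← Finset.sum_add_distrib]
  -- per cell: the summand is `∫_{cell} G_j` with `|G_j| ≤ Cst`
  have hper : ∀ j ∈ range N,
      |∑ k, 2 * y k ((j : ℝ≥0) / 2 ^ n) *
          (∫ s in ((((j : ℝ≥0) / 2 ^ n : ℝ≥0)) : ℝ)..((((j + 1 : ℕ) : ℝ≥0) / 2 ^ n : ℝ≥0) : ℝ), b k s.toNNReal) +
        ∑ k, ∑ n', clamp n (σ k n' ((j : ℝ≥0) / 2 ^ n)) ^ 2 * (1 / 2 ^ n)| ≤ (1 / 2 ^ n) * Cst := by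
    intro j hj
    set g : ℝ≥0 := (j : ℝ≥0) / 2 ^ n with hg
    set a : ℝ := ((((j : ℝ≥0) / 2 ^ n : ℝ≥0)) : ℝ) with ha
    set a' : ℝ := ((((j + 1 : ℕ) : ℝ≥0) / 2 ^ n : ℝ≥0) : ℝ) with ha'
    have haa' : a' - a = 1 / 2 ^ n := hstep j
    have hgt : g ≤ t := le_trans (div_le_div_of_nonneg_right (by exact_mod_cast Nat.le_succ j)
      (pow_pos two_pos n).le) (hcell j hj)
    -- clamp inactive at the grid point
    have hcl : ∀ k n', clamp n (σ k n' g) = σ k n' g := fun k n' => clamp_eq_self (hclamp k n' g hgt)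
    simp_rw [hcl]
    -- the integrand `G` and its primitive form `H`
    set G : ℝ → ℝ := fun s => ∑ k, 2 * (y k g - y k s.toNNReal) * b k s.toNNReal +
      ∑ k, ∑ n', (σ k n' g ^ 2 - σ k n' s.toNNReal ^ 2) with hG
    have hbi : ∀ k, IntervalIntegrable (fun s : ℝ => b k s.toNNReal) volume a a' := fun k =>
      ((hb k).comp continuous_real_toNNReal).intervalIntegrable _ _
    have hHint : ∫ s in a..a', (∑ k, 2 * y k g * b k s.toNNReal + ∑ k, ∑ n', σ k n' g ^ 2) =
        ∑ k, 2 * y k g * (∫ s in a..a', b k s.toNNReal) + ∑ k, ∑ n', σ k n' g ^ 2 * (1 / 2 ^ n) := by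
      rw [intervalIntegral.integral_add, intervalIntegral.integral_const, haa',
        intervalIntegral.integral_finsetSum]
      · congr 1
        · exact Finset.sum_congr rfl fun k _ => intervalIntegral.integral_const_mul _ _
        · rw [smul_eq_mul, Finset.mul_sum]; congr 1; ext k; rw [Finset.mul_sum]; congr 1; ext n'; ring
      · exact fun k _ => (hbi k).const_mul _
      · exact (continuous_finsetSum _ fun k _ =>
          (((hb k).comp continuous_real_toNNReal).const_mul (2 * y k g))).intervalIntegrable _ _
      · exact intervalIntegrable_const
    have hGH : ∀ s : ℝ, G s = ∑ k, 2 * y k g * b k s.toNNReal + ∑ k, ∑ n', σ k n' g ^ 2 := by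
      intro s
      have hT := hT1 s.toNNReal
      simp only [hG, sub_mul, mul_sub, Finset.sum_sub_distrib]
      rw [Finset.mul_sum] at hT
      simp only [← mul_assoc] at hT
      linear_combination (-1 : ℝ) * hT
    have hcellEq : ∑ k, 2 * y k g * (∫ s in a..a', b k s.toNNReal) + ∑ k, ∑ n', σ k n' g ^ 2 * (1 / 2 ^ n) =
        ∫ s in a..a', G s := by
      rw [← hHint]; exact intervalIntegral.integral_congr fun s _ => (hGH s).symm
    rw [hcellEq]
    -- bound the integrand on the cell
    have hGle : ∀ s ∈ Set.uIoc a a', ‖G s‖ ≤ Cst := by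
      intro s hs
      obtain ⟨hst, hgs, hdist⟩ := toNNReal_mem_cell (hcell j hj) (Set.uIoc_subset_uIcc hs)
      rw [Real.norm_eq_abs, hG]
      refine (abs_add_le _ _).trans (add_le_add ?_ ?_)
      · refine (Finset.abs_sum_le_sum_abs _ _).trans ?_
        calc ∑ k, |2 * (y k g - y k s.toNNReal) * b k s.toNNReal| ≤ ∑ _k : ι, 2 * η * B :=
              Finset.sum_le_sum fun k _ => by
                rw [abs_mul, abs_mul, abs_two]
                have hy' := hηy k g s.toNNReal hgt hst hdist
                have hb' := hB k s.toNNReal hst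
                have hη0 : 0 ≤ η := (abs_nonneg _).trans hy'
                calc 2 * |y k g - y k s.toNNReal| * |b k s.toNNReal| ≤ 2 * η * B :=
                  mul_le_mul (mul_le_mul_of_nonneg_left hy' zero_le_two) hb' (abs_nonneg _) (by positivity)
                  _ = 2 * η * B := rfl
          _ = 2 * Fintype.card ι * B * η := by rw [Finset.sum_const, Finset.card_univ, nsmul_eq_mul]; ring
      · refine (Finset.abs_sum_le_sum_abs _ _).trans ?_
        calc ∑ k, |∑ n', (σ k n' g ^ 2 - σ k n' s.toNNReal ^ 2)| ≤ ∑ _k : ι, ∑ _n' : κ, η :=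
              Finset.sum_le_sum fun k _ => (Finset.abs_sum_le_sum_abs _ _).trans
                (Finset.sum_le_sum fun n' _ => hησ k n' g s.toNNReal hgt hst hdist)
          _ = Fintype.card ι * Fintype.card κ * η := by
            rw [Finset.sum_const, Finset.card_univ, nsmul_eq_mul, Finset.sum_const, Finset.card_univ,
              nsmul_eq_mul]; ring
    have h := intervalIntegral.norm_integral_le_of_norm_le_const hGle
    rw [haa', Real.norm_eq_abs, abs_of_pos (by positivity : (0 : ℝ) < 1 / 2 ^ n), mul_comm] at h
    exact h
  calc |∑ j ∈ range N, (∑ k, 2 * y k ((j : ℝ≥0) / 2 ^ n) *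
          (∫ s in ((((j : ℝ≥0) / 2 ^ n : ℝ≥0)) : ℝ)..((((j + 1 : ℕ) : ℝ≥0) / 2 ^ n : ℝ≥0) : ℝ), b k s.toNNReal) +
        ∑ k, ∑ n', clamp n (σ k n' ((j : ℝ≥0) / 2 ^ n)) ^ 2 * (1 / 2 ^ n))|
      ≤ ∑ j ∈ range N, |∑ k, 2 * y k ((j : ℝ≥0) / 2 ^ n) *
          (∫ s in ((((j : ℝ≥0) / 2 ^ n : ℝ≥0)) : ℝ)..((((j + 1 : ℕ) : ℝ≥0) / 2 ^ n : ℝ≥0) : ℝ), b k s.toNNReal) +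
        ∑ k, ∑ n', clamp n (σ k n' ((j : ℝ≥0) / 2 ^ n)) ^ 2 * (1 / 2 ^ n)| := Finset.abs_sum_le_sum_abs _ _
    _ ≤ ∑ _j ∈ range N, (1 / 2 ^ n) * Cst := Finset.sum_le_sum hper
    _ = (N * (1 / 2 ^ n)) * Cst := by rw [Finset.sum_const, Finset.card_range, nsmul_eq_mul]; ring

/-- A uniform bound for finitely many continuous functions on `[0, t] ⊆ ℝ≥0`. [folklore] -/
theorem exists_bound_le {α : Type*} [Fintype α] (f : α → ℝ≥0 → ℝ) (hf : ∀ a, Continuous (f a)) (t : ℝ≥0) :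
    ∃ B : ℝ, 0 ≤ B ∧ ∀ a, ∀ s ≤ t, |f a s| ≤ B := by
  have hF : Continuous fun s => ∑ a, |f a s| := continuous_finsetSum _ fun a _ => (hf a).abs
  obtain ⟨C, hC⟩ := (isCompact_Icc (a := (0 : ℝ≥0)) (b := t)).exists_bound_of_continuousOn hF.continuousOn
  refine ⟨max C 0, le_max_right _ _, fun a s hs => ?_⟩
  have h := hC s ⟨bot_le, hs⟩
  rw [Real.norm_eq_abs, abs_of_nonneg (Finset.sum_nonneg fun a _ => abs_nonneg _)] at h
  exact ((Finset.single_le_sum (fun a _ => abs_nonneg (f a s)) (Finset.mem_univ a)).trans h).trans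
    (le_max_left _ _)

/-- A uniform modulus of continuity for finitely many continuous functions on `[0, t] ⊆ ℝ≥0`. [folklore] -/
theorem exists_modulus_le {α : Type*} [Fintype α] (f : α → ℝ≥0 → ℝ) (hf : ∀ a, Continuous (f a)) (t : ℝ≥0)
    {ε : ℝ} (hε : 0 < ε) :
    ∃ δ : ℝ, 0 < δ ∧ ∀ a (s s' : ℝ≥0), s ≤ t → s' ≤ t → dist s s' < δ → |f a s - f a s'| ≤ ε := by
  set Φ : ℝ≥0 → (α → ℝ) := fun s a => f a s
  have hΦ : Continuous Φ := continuous_pi fun a => hf a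
  have hU := (isCompact_Icc (a := (0 : ℝ≥0)) (b := t)).uniformContinuousOn_of_continuous hΦ.continuousOn
  obtain ⟨δ, hδ, h⟩ := Metric.uniformContinuousOn_iff.1 hU ε hε
  refine ⟨δ, hδ, fun a s s' hs hs' hd => ?_⟩
  have h1 := h s ⟨bot_le, hs⟩ s' ⟨bot_le, hs'⟩ hd
  have h2 : dist (Φ s a) (Φ s' a) ≤ dist (Φ s) (Φ s') := dist_le_pi_dist _ _ a
  rw [Real.dist_eq] at h2
  exact h2.trans h1.le

/-- `2^{-n_l} → 0` along levels `n_l → ∞`, eventually below any `δ > 0`. [folklore] -/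
theorem eventually_inv_pow_lt {lv : ℕ → ℕ} (hlv : Tendsto lv atTop atTop) {δ : ℝ} (hδ : 0 < δ) :
    ∀ᶠ l in atTop, (1 : ℝ) / 2 ^ (lv l) < δ := by
  have h := ((tendsto_pow_atTop_nhds_zero_of_lt_one (by norm_num : (0 : ℝ) ≤ 1 / 2)
    (by norm_num : (1 : ℝ) / 2 < 1)).comp hlv).eventually (gt_mem_nhds hδ)
  refine h.mono fun l hl => ?_
  simpa [one_div_pow, Function.comp] using hl

/-- **The PATH term tends to `0`** along any levels `n_l → ∞` with `N_l / 2^{n_l} = t` (continuity of the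
paths on `[0, t]` + tangency `T1`). [folklore] -/
theorem pathTerm_tendsto_zero {ι κ : Type*} [Fintype ι] [Fintype κ] (y b : ι → ℝ≥0 → ℝ)
    (σ : ι → κ → ℝ≥0 → ℝ) (hb : ∀ k, Continuous (b k)) (hσ : ∀ k n', Continuous (σ k n'))
    (hy : ∀ k, Continuous (y k)) (hT1 : ∀ s, 2 * ∑ k, y k s * b k s + ∑ k, ∑ n', σ k n' s ^ 2 = 0)
    {t : ℝ≥0} {lv N : ℕ → ℕ} (hlv : Tendsto lv atTop atTop) (hNt : ∀ l, ((N l : ℝ≥0) / 2 ^ (lv l)) = t) :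
    Tendsto (fun l => ∑ j ∈ range (N l), ∑ k, 2 * y k ((j : ℝ≥0) / 2 ^ (lv l)) *
        (∫ s in ((((j : ℝ≥0) / 2 ^ (lv l) : ℝ≥0)) : ℝ)..((((j + 1 : ℕ) : ℝ≥0) / 2 ^ (lv l) : ℝ≥0) : ℝ),
          b k s.toNNReal) +
      ∑ j ∈ range (N l), ∑ k, ∑ n', clamp (lv l) (σ k n' ((j : ℝ≥0) / 2 ^ (lv l))) ^ 2 * (1 / 2 ^ (lv l)))
      atTop (𝓝 0) := by
  obtain ⟨B, hB0, hB⟩ := exists_bound_le b hb t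
  obtain ⟨S, -, hS⟩ := exists_bound_le (fun p : ι × κ => σ p.1 p.2) (fun p => hσ p.1 p.2) t
  set K : ℝ := 2 * Fintype.card ι * B + Fintype.card ι * Fintype.card κ with hK
  have hK0 : 0 ≤ K := by positivity
  have hNt' : ∀ l, ((N l : ℝ) * (1 / 2 ^ (lv l))) = t := fun l => by
    have := congrArg (fun x : ℝ≥0 => (x : ℝ)) (hNt l); push_cast at this; rw [← this]; ring
  refine Metric.tendsto_atTop.2 fun ε hε => ?_
  -- oscillation target `η`
  set η : ℝ := ε / (2 * ((t : ℝ) * K + 1)) with hη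
  have hη0 : 0 < η := by positivity
  obtain ⟨δ₁, hδ₁, hmy⟩ := exists_modulus_le y hy t hη0
  obtain ⟨δ₂, hδ₂, hmσ⟩ := exists_modulus_le (fun p : ι × κ => fun s => σ p.1 p.2 s ^ 2)
    (fun p => (hσ p.1 p.2).pow 2) t hη0
  have hev : ∀ᶠ l in atTop, (1 : ℝ) / 2 ^ (lv l) < min δ₁ δ₂ ∧ S ≤ (lv l : ℝ) :=
    (eventually_inv_pow_lt hlv (lt_min hδ₁ hδ₂)).and
      (hlv.eventually (eventually_ge_atTop ⌈S⌉₊) |>.mono fun l hl => (Nat.le_ceil S).trans (by exact_mod_cast hl))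
  obtain ⟨L, hL⟩ := eventually_atTop.1 hev
  refine ⟨L, fun l hl => ?_⟩
  obtain ⟨hsmall, hSl⟩ := hL l hl
  rw [Real.dist_0_eq_abs]
  have hmain := abs_pathTerm_le y b σ hb hT1 (t := t) (n := lv l) (N := N l) (hNt l).le hB
    (fun k s s' hs hs' hd => hmy k s s' hs hs' (hd.trans_lt (hsmall.trans_le (min_le_left _ _))))
    (fun k n' s s' hs hs' hd => hmσ (k, n') s s' hs hs' (hd.trans_lt (hsmall.trans_le (min_le_right _ _))))
    (fun k n' s hs => (hS (k, n') s hs).trans hSl)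
  refine hmain.trans_lt ?_
  rw [hNt']
  calc (t : ℝ) * (2 * Fintype.card ι * B * η + Fintype.card ι * Fintype.card κ * η) = (t : ℝ) * K * η := by
        rw [hK]; ring
    _ ≤ ((t : ℝ) * K + 1) * η := mul_le_mul_of_nonneg_right (by linarith) hη0.le
    _ = ε / 2 := by rw [hη]; field_simp
    _ < ε := half_lt_self hε

/-- **Cell integrals of a bounded drift**: `|∫_{cell j} b| ≤ B 2⁻ⁿ` for a cell inside `[0, t]`. [folklore] -/
theorem abs_cellIntegral_le (b : ℝ≥0 → ℝ) {t : ℝ≥0} {n j : ℕ} (hjt : (((j + 1 : ℕ) : ℝ≥0) / 2 ^ n) ≤ t)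
    {B : ℝ} (hB : ∀ s ≤ t, |b s| ≤ B) :
    |∫ s in ((((j : ℝ≥0) / 2 ^ n : ℝ≥0)) : ℝ)..((((j + 1 : ℕ) : ℝ≥0) / 2 ^ n : ℝ≥0) : ℝ), b s.toNNReal| ≤
      B * (1 / 2 ^ n) := by
  have hstep : ((((j + 1 : ℕ) : ℝ≥0) / 2 ^ n : ℝ≥0) : ℝ) - ((((j : ℝ≥0) / 2 ^ n : ℝ≥0)) : ℝ) = 1 / 2 ^ n := by
    rw [coe_dyadicGrid, coe_dyadicGrid]; push_cast; field_simp; ring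
  have h := intervalIntegral.norm_integral_le_of_norm_le_const (a := ((((j : ℝ≥0) / 2 ^ n : ℝ≥0)) : ℝ))
    (b := ((((j + 1 : ℕ) : ℝ≥0) / 2 ^ n : ℝ≥0) : ℝ)) (f := fun s : ℝ => b s.toNNReal) (C := B)
    fun s hs => by
      rw [Real.norm_eq_abs]
      exact hB _ (toNNReal_mem_cell hjt (Set.uIoc_subset_uIcc hs)).1
  rw [hstep, Real.norm_eq_abs, abs_of_pos (by positivity : (0 : ℝ) < 1 / 2 ^ n)] at h
  exact h

/-- **Quadratic sums of the drift increments vanish**: `Σ_{j<N_l} (∫_{cell j} b)² ≤ t B² 2^{-n_l} → 0`.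
[folklore] -/
theorem quadSum_drift_tendsto_zero (b : ℝ≥0 → ℝ) (hb : Continuous b) {t : ℝ≥0} {lv N : ℕ → ℕ}
    (hlv : Tendsto lv atTop atTop) (hNt : ∀ l, ((N l : ℝ≥0) / 2 ^ (lv l)) = t) :
    Tendsto (fun l => ∑ j ∈ range (N l),
        (∫ s in ((((j : ℝ≥0) / 2 ^ (lv l) : ℝ≥0)) : ℝ)..((((j + 1 : ℕ) : ℝ≥0) / 2 ^ (lv l) : ℝ≥0) : ℝ),
          b s.toNNReal) ^ 2) atTop (𝓝 0) := by
  obtain ⟨B, hB0, hB⟩ := exists_bound_le (fun _ : Unit => b) (fun _ => hb) t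
  have hNt' : ∀ l, ((N l : ℝ) * (1 / 2 ^ (lv l))) = t := fun l => by
    have := congrArg (fun x : ℝ≥0 => (x : ℝ)) (hNt l); push_cast at this; rw [← this]; ring
  have hcell : ∀ l, ∀ j ∈ range (N l), (((j + 1 : ℕ) : ℝ≥0) / 2 ^ (lv l)) ≤ t := fun l j hj =>
    (div_le_div_of_nonneg_right (by exact_mod_cast (mem_range.1 hj : j < N l)) (pow_pos two_pos _).le).trans
      (hNt l).le
  have hbound : ∀ l, ∑ j ∈ range (N l),
      (∫ s in ((((j : ℝ≥0) / 2 ^ (lv l) : ℝ≥0)) : ℝ)..((((j + 1 : ℕ) : ℝ≥0) / 2 ^ (lv l) : ℝ≥0) : ℝ),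
        b s.toNNReal) ^ 2 ≤ (t : ℝ) * B ^ 2 * (1 / 2) ^ (lv l) := by
    intro l
    calc ∑ j ∈ range (N l), (∫ s in ((((j : ℝ≥0) / 2 ^ (lv l) : ℝ≥0)) : ℝ)..((((j + 1 : ℕ) : ℝ≥0) /
            2 ^ (lv l) : ℝ≥0) : ℝ), b s.toNNReal) ^ 2
        ≤ ∑ _j ∈ range (N l), (B * (1 / 2 ^ (lv l))) ^ 2 := Finset.sum_le_sum fun j hj => by
            have h := abs_le.1 (abs_cellIntegral_le b (hcell l j hj) (hB ()))
            exact sq_le_sq' h.1 h.2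
      _ = (N l : ℝ) * (1 / 2 ^ (lv l)) * (B ^ 2 * (1 / 2 ^ (lv l))) := by
            rw [Finset.sum_const, Finset.card_range, nsmul_eq_mul]; ring
      _ = (t : ℝ) * B ^ 2 * (1 / 2) ^ (lv l) := by rw [hNt', one_div_pow]; ring
  have hlim : Tendsto (fun l => (t : ℝ) * B ^ 2 * (1 / 2) ^ (lv l)) atTop (𝓝 0) := by
    have h := ((tendsto_pow_atTop_nhds_zero_of_lt_one (by norm_num : (0 : ℝ) ≤ 1 / 2)
      (by norm_num : (1 : ℝ) / 2 < 1)).comp hlv).const_mul ((t : ℝ) * B ^ 2)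
    rw [mul_zero] at h
    exact h
  exact squeeze_zero (fun l => Finset.sum_nonneg fun j _ => sq_nonneg _) hbound hlim

end Summit.QuantumFields.YangMills.Theorems.ColdStartUniversality

end
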